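import Mathlib
import Summits.Ventures.PercRepro.TriangleCapThreeRowOneStrict

/-!
# PercRepro — THE CAP ON THE CELL `(k, 3, 1)` WITH EVERY DEGREE `≥ 3` IS STRICT FOR EVERY `k ≥ 8` — the cell
`(8, 14)` with an edge between the two non-neighbours (p3, gen 45; part 200c)

Part 200a′'s cap lemma excluded an edge `u v` between the non-neighbours of a cap vertex by the count, which needs
`K = k − 3 ≥ 7`. Here (`three_one_cap_strict'`, `k ≥ 8`): every `y ∈ N(x)` has degree `≤ 3` whatever `E` is (a matched
vertex with both `u, v` leaves its partner at degree `2`, against every degree `≥ 3`), every `u ∈ R` has degree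
`≤ K − M + 1` (`≤ K − M` when `E = 0`); with `E = 0` the count gives `M ≤ 1` and `M = 1` is `2` below the value for
every `K ≥ 5` (`three_one_cap_arith'`); with `E = 2` the count forces `K = 5`, `M = 2`, `P = 6` — the cell `(8, 14)` —
and `Σ d² ≤ 25 + 3 · 15 + 4 · 8 = 102`, the value `104` minus `2`. Axioms: standard.
-/

namespace PercRepro

namespace TriangleCap

namespace C047

open Finset

variable {V : Type*} [Fintype V] [DecidableEq V]

/-- The arithmetic of the strict cap, `E = 0`, `M = 1`, for `K ≥ 5`: `m + 1 = 3K`, `2K + 2 + 2P = 2m`, `S_N ≤ 9K`,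
`S_R ≤ (K − 1) P` ⇒ `K² + S_N + S_R + (k − 2) + 2 (k − 7) + 2 ≤ m k`, `k = K + 3`. -/
theorem three_one_cap_arith' (K P SN SR m : ℕ) (hK : 5 ≤ K) (hm : m + 1 = 3 * K) (hP : 2 * K + 2 + 2 * P = 2 * m)
    (hSN : SN ≤ 9 * K) (hSR : SR ≤ (K - 1) * P) :
    K * K + SN + SR + (K + 3 - 2) + 2 * (K + 3 - 7) + 2 ≤ m * (K + 3) := by
  obtain ⟨t, rfl⟩ : ∃ t, K = t + 5 := ⟨K - 5, by omega⟩
  have hP' : P = 2 * t + 8 := by omega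
  have hm' : m = 3 * t + 14 := by omega
  subst hP' hm'
  have e1 : t + 5 + 3 - 2 = t + 6 := by omega
  have e2 : t + 5 + 3 - 7 = t + 1 := by omega
  have e3 : t + 5 - 1 = t + 4 := by omega
  rw [e1, e2]
  rw [e3] at hSR
  nlinarith [hSN, hSR]

/-- **THE CAP ON THE CELL `(k, 3, 1)` WITH EVERY DEGREE `≥ 3`, `k ≥ 8`, IS STRICT:** a vertex `x` of degree `k − 3`
makes `D` `3`-bipartite or `Σ_v d(v)² + (k − 2) + 2 (k − 7) + 2 ≤ m k`. -/
theorem three_one_cap_strict' (D : SimpleGraph V) [DecidableRel D.Adj] (hK : K4mFree D)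
    (hk : 8 ≤ Fintype.card V) (hm : D.edgeFinset.card + 1 = 3 * (Fintype.card V - 3))
    (hdeg3 : ∀ v, 3 ≤ deg D v) (x : V) (hx : deg D x + 3 = Fintype.card V) :
    (∃ A : Finset V, A.card = 3 ∧ BipSub D A) ∨
      ∑ v, deg D v * deg D v + (Fintype.card V - 2) + 2 * (Fintype.card V - 7) + 2 ≤
        D.edgeFinset.card * Fintype.card V := by
  obtain ⟨N, hN⟩ : ∃ N : Finset V, N = univ.filter (fun w => D.Adj x w) := ⟨_, rfl⟩
  have hmemN : ∀ w, w ∈ N ↔ D.Adj x w := fun w => by rw [hN, mem_filter]; simp only [mem_univ, true_and]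
  have hxN : x ∉ N := fun h => D.irrefl ((hmemN x).mp h)
  have hdx : deg D x = N.card := by rw [hN]; rfl
  obtain ⟨K, hKdef⟩ : ∃ K, N.card = K := ⟨_, rfl⟩
  have hcardV : Fintype.card V = K + 3 := by omega
  obtain ⟨m, hmdef⟩ : ∃ m, D.edgeFinset.card = m := ⟨_, rfl⟩
  rw [hmdef, hcardV, Nat.add_sub_cancel] at hm
  -- the non-neighbours `R`, `|R| = 2`
  obtain ⟨R, hR⟩ : ∃ R : Finset V, R = (insert x N)ᶜ := ⟨_, rfl⟩
  have hRcard : R.card = 2 := by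
    rw [hR, card_compl, card_insert_of_notMem hxN]
    omega
  have hmemR : ∀ w, w ∈ R ↔ w ≠ x ∧ ¬ D.Adj x w := by
    intro w
    rw [hR, mem_compl, mem_insert, hmemN]
    tauto
  -- the matching inside `N`
  obtain ⟨M, hM⟩ : ∃ M, adjPairs D N = 2 * M := ⟨_, adjPairs_eq_two_mul D N⟩
  have hTf : ∑ y ∈ N, degIn D N y = 2 * M := by rw [← adjPairs_eq_sum_degIn, hM]
  have hfle : ∀ y ∈ N, degIn D N y ≤ 1 := by
    intro y hy
    have h1 := degIn_nbhd_le_one D hK (x := x) (u := y) ((hmemN y).mp hy)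
    rw [← hN] at h1
    exact h1
  have hMK : 2 * M ≤ K := by
    have : ∑ y ∈ N, degIn D N y ≤ ∑ _y ∈ N, 1 := sum_le_sum hfle
    rw [hTf, sum_const, smul_eq_mul, mul_one, hKdef] at this
    exact this
  obtain ⟨P, hPdef⟩ : ∃ P, ∑ u ∈ R, degIn D N u = P := ⟨_, rfl⟩
  obtain ⟨E, hEdef⟩ : ∃ E, adjPairs D R = E := ⟨_, rfl⟩
  have hsplit : ∀ F : V → ℕ, ∑ w, F w = F x + ∑ y ∈ N, F y + ∑ u ∈ R, F u := by
    intro F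
    rw [← sum_add_sum_compl (insert x N), sum_insert hxN, ← hR]
  have hdegN : ∀ y ∈ N, deg D y = 1 + degIn D N y + degIn D R y := by
    intro y hy
    have := deg_eq_of_mem_nbhd D x y ((hmemN y).mp hy)
    rw [← hN, ← hR] at this
    exact this
  have hsumN : ∑ y ∈ N, deg D y = K + 2 * M + P := by
    rw [sum_congr rfl hdegN, sum_add_distrib, sum_add_distrib, sum_const, smul_eq_mul, mul_one, hKdef, hTf,
      sum_degIn_comm D N R, hPdef]
  have hdegR : ∀ u ∈ R, deg D u = degIn D N u + degIn D R u := by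
    intro u hu
    have := deg_eq_of_not_mem_nbhd D x u ((hmemR u).mp hu).2
    rw [← hN, ← hR] at this
    exact this
  have hsumR : ∑ u ∈ R, deg D u = P + E := by
    rw [sum_congr rfl hdegR, sum_add_distrib, hPdef, ← adjPairs_eq_sum_degIn, hEdef]
  have hdegsum := sum_deg_eq D
  rw [hsplit, hsumN, hsumR, hdx, hKdef, hmdef] at hdegsum
  have hPle : ∀ u ∈ R, degIn D N u + M ≤ K := by
    intro u hu
    have := two_mul_degIn_add_adjPairs_le D hK (x := x) ((hmemR u).mp hu).1
    rw [← hN, hM, hKdef] at this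
    omega
  have h2 : P + 2 * M ≤ 2 * K := by
    have hs : ∑ u ∈ R, (degIn D N u + M) ≤ ∑ _u ∈ R, K := sum_le_sum hPle
    rw [sum_add_distrib, sum_const, sum_const, smul_eq_mul, smul_eq_mul, hPdef, hRcard] at hs
    exact hs
  have hE2 : E ≤ 2 := by
    have := adjPairs_le_card_mul_pred D R
    rw [hEdef, hRcard] at this
    exact this
  -- an edge inside `R` forces `P ≤ K + 1`
  have hnoedge : 1 ≤ E → P ≤ K + 1 := by
    intro hE
    obtain ⟨u, hu, hu1⟩ : ∃ u ∈ R, 1 ≤ degIn D R u := by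
      by_contra hcon
      push Not at hcon
      have h0 : ∑ u ∈ R, degIn D R u = 0 := sum_eq_zero (fun u hu => by have := hcon u hu; omega)
      rw [← adjPairs_eq_sum_degIn, hEdef] at h0
      omega
    obtain ⟨v, hv, huv⟩ : ∃ v ∈ R, D.Adj u v := by
      unfold degIn at hu1
      obtain ⟨v, hv⟩ := card_pos.mp hu1
      rw [mem_filter] at hv
      exact ⟨v, hv.1, hv.2⟩
    have hne : u ≠ v := D.ne_of_adj huv
    have hPuv : degIn D N u + degIn D N v ≤ K + 1 := by
      have := degIn_add_degIn_le_of_adj_pair D hK N huv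
      rw [hKdef] at this
      exact this
    have hRuv : R = {u, v} := by
      symm
      apply eq_of_subset_of_card_le
      · intro w hw
        rw [mem_insert, mem_singleton] at hw
        rcases hw with rfl | rfl
        · exact hu
        · exact hv
      · rw [hRcard, card_pair hne]
    rw [hRuv, sum_pair hne] at hPdef
    omega
  -- every vertex of `N` has degree `≤ 3` (the partner argument, independent of `E`)
  have hdegN3 : ∀ y ∈ N, deg D y ≤ 3 := by
    intro y hy
    have hgle : degIn D R y ≤ 2 := by
      have := degIn_le_card D R y
      rw [hRcard] at this
      exact this
    rcases Nat.eq_zero_or_pos (degIn D N y) with hf0 | hfpos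
    · rw [hdegN y hy, hf0]
      omega
    · obtain ⟨y', hy'N, hyy'⟩ : ∃ y' ∈ N, D.Adj y y' := by
        unfold degIn at hfpos
        obtain ⟨y', hy'⟩ := card_pos.mp hfpos
        rw [mem_filter] at hy'
        exact ⟨y', hy'.1, hy'.2⟩
      have hpair := degIn_add_degIn_le_card_of_nbhd_edge D hK x R (fun u hu => ((hmemR u).mp hu).1)
        ((hmemN y).mp hy) ((hmemN y').mp hy'N) hyy'
      rw [hRcard] at hpair
      have h3 := hdeg3 y'
      rw [hdegN y' hy'N] at h3
      have hf' := hfle y' hy'N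
      have hf := hfle y hy
      rw [hdegN y hy]
      omega
  have hSN : ∑ y ∈ N, deg D y * deg D y ≤ 3 * (K + 2 * M + P) := by
    calc ∑ y ∈ N, deg D y * deg D y ≤ ∑ y ∈ N, 3 * deg D y :=
          sum_le_sum (fun y hy => Nat.mul_le_mul_right _ (hdegN3 y hy))
      _ = 3 * (K + 2 * M + P) := by rw [← mul_sum, hsumN]
  -- every vertex of `R` has degree `≤ K − M + degIn R`, `degIn R ≤ 1`
  have hSR : ∑ u ∈ R, deg D u * deg D u ≤ (K - M + 1) * (P + E) := by
    have h : ∀ u ∈ R, deg D u * deg D u ≤ (K - M + 1) * deg D u := by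
      intro u hu
      have hle : deg D u ≤ K - M + 1 := by
        have h1 := hPle u hu
        have h2 : degIn D R u ≤ 1 := by
          have := degIn_le_card_sub_one D hu
          rw [hRcard] at this
          exact this
        rw [hdegR u hu]
        omega
      exact Nat.mul_le_mul_right _ hle
    calc ∑ u ∈ R, deg D u * deg D u ≤ ∑ u ∈ R, (K - M + 1) * deg D u := sum_le_sum h
      _ = (K - M + 1) * (P + E) := by rw [← mul_sum, hsumR]
  have hSR0 : E = 0 → ∑ u ∈ R, deg D u * deg D u ≤ (K - M) * P := by
    intro hE0
    have hnoR : ∀ u ∈ R, degIn D R u = 0 := by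
      intro u hu
      have hle : degIn D R u ≤ ∑ z ∈ R, degIn D R z := single_le_sum (fun _ _ => Nat.zero_le _) hu
      rw [← adjPairs_eq_sum_degIn, hEdef, hE0] at hle
      exact Nat.le_zero.mp hle
    have h : ∀ u ∈ R, deg D u * deg D u ≤ (K - M) * degIn D N u := by
      intro u hu
      have e : deg D u = degIn D N u := by rw [hdegR u hu, hnoR u hu, add_zero]
      have hle : degIn D N u ≤ K - M := by have := hPle u hu; omega
      rw [e]
      exact Nat.mul_le_mul_right _ hle
    calc ∑ u ∈ R, deg D u * deg D u ≤ ∑ u ∈ R, (K - M) * degIn D N u := sum_le_sum h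
      _ = (K - M) * P := by rw [← mul_sum, hPdef]
  rcases Nat.eq_zero_or_pos E with hE0 | hEpos
  · -- `E = 0`: `M ≤ 1`
    have hM1 : M ≤ 1 := by
      rw [hE0] at hdegsum
      omega
    rcases Nat.eq_zero_or_pos M with hM0 | hMpos
    · -- `M = 0`: `D ⊆ K(Nᶜ, N)`
      left
      have hnoR : ∀ u ∈ R, degIn D R u = 0 := by
        intro u hu
        have hle : degIn D R u ≤ ∑ z ∈ R, degIn D R z := single_le_sum (fun _ _ => Nat.zero_le _) hu
        rw [← adjPairs_eq_sum_degIn, hEdef, hE0] at hle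
        exact Nat.le_zero.mp hle
      have hnoN : ∀ y ∈ N, ∀ y', D.Adj y y' → y' ∉ N := by
        intro y hy y' hyy' hy'
        have h0 : degIn D N y = 0 := by
          have hle : degIn D N y ≤ ∑ z ∈ N, degIn D N z := single_le_sum (fun _ _ => Nat.zero_le _) hy
          rw [hTf, hM0, mul_zero] at hle
          exact Nat.le_zero.mp hle
        unfold degIn at h0
        rw [card_eq_zero, filter_eq_empty_iff] at h0
        exact h0 hy' hyy'
      have hnoR' : ∀ u ∈ R, ∀ u', D.Adj u u' → u' ∉ R := by
        intro u hu u' huu' hu'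
        have h0 := hnoR u hu
        unfold degIn at h0
        rw [card_eq_zero, filter_eq_empty_iff] at h0
        exact h0 hu' huu'
      refine ⟨Nᶜ, ?_, ?_⟩
      · rw [card_compl, hKdef]
        omega
      · intro p q hpq
        rw [mem_compl, mem_compl, not_not]
        constructor
        · intro hpN
          by_contra hqN
          by_cases hpx : p = x
          · subst hpx
            exact hqN ((hmemN q).mpr hpq)
          by_cases hqx : q = x
          · subst hqx
            exact hpN ((hmemN p).mpr (D.adj_symm hpq))
          have hpR : p ∈ R := (hmemR p).mpr ⟨hpx, fun h => hpN ((hmemN p).mpr h)⟩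
          have hqR : q ∈ R := (hmemR q).mpr ⟨hqx, fun h => hqN ((hmemN q).mpr h)⟩
          exact hnoR' p hpR q hpq hqR
        · intro hqN hpN
          exact hnoN p hpN q hpq hqN
    · right
      have hM1' : M = 1 := by omega
      have hSR' := hSR0 hE0
      rw [hsplit (fun v => deg D v * deg D v), hdx, hKdef, hmdef, hcardV]
      rw [hM1', hE0] at hdegsum
      rw [hM1'] at hSN hSR'
      have hSN' : ∑ y ∈ N, deg D y * deg D y ≤ 9 * K := by omega
      exact three_one_cap_arith' K P _ _ m (by omega) hm (by omega) hSN' hSR'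
  · -- `E = 2`: `K = 5`, `M = 2`, `P = 6` — the cell `(8, 14)`
    right
    have hP := hnoedge hEpos
    have hK5 : K = 5 := by omega
    have hM2 : M = 2 := by omega
    have hP6 : P = 6 := by omega
    have hE2' : E = 2 := by omega
    rw [hsplit (fun v => deg D v * deg D v), hdx, hKdef, hmdef, hcardV]
    rw [hK5, hM2, hP6] at hSN
    rw [hK5, hM2, hP6, hE2'] at hSR
    have hm8 : m = 14 := by omega
    rw [hK5, hm8]
    norm_num at hSN hSR ⊢
    omega

end C047

end TriangleCap

end PercRepro
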